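/-
Copyright (c) 2026. All rights reserved.
Released under Apache 2.0 license as described in the file LICENSE.
-/
import Literature.NumberTheory.ComplexMultiplication.DegenerateCMTypesAbelianSporadicSubsets
import Mathlib.Algebra.MonoidAlgebra.Basic
import Mathlib.Algebra.MonoidAlgebra.Module
import Mathlib.LinearAlgebra.Dual.Lemmas
import Mathlib.RingTheory.Ideal.Defs
import HarnessLib

/-!
# White 1993, Lemma 3 in full: every nonzero submodule of `ℚ[G]` (`G` finite abelian) contains a
# nonzero element whose coefficients are `0, ±1`

S. P. White, *Sporadic cycles on CM abelian varieties*, Compositio Math. **88** (1993) 123–142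
[White1993SporadicCycles] (NUMDAM `CM_1993__88_2_123_0`, held text `paper:url-2830691ae55d`, p0010 = p. 131):

> "LEMMA 3. If `G` is abelian, every submodule `N` of `ℚ[G]⁻` has a nonzero element `β` whose coefficients are
> `0, ±1`.  Proof. Since `G` is abelian `ℚ[G]⁻ ⊗ ℂ = ⊕_{χ odd} ℂ e_χ` where `e_χ = Σ_{g∈G} χ(g) g`. Because `N` is
> defined over `ℚ`, `N ⊗ ℂ ⊇ ⊕_{χ' conjugate to χ} ℂ e_{χ'}` for some odd `χ`. Let `H` be the kernel of `χ`. Let `σ`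
> generate the cyclic group `G/H` and assume `σ^m = c`, `σ^{2m} = 1`. Then `χ` generates the character group of
> `G/H` and `χ` and `χᵗ` are conjugate ⟺ `(t, 2m) = 1`. Let `β = ∏_{p | 2m} (1 − σ^{2m/p})`. Then if an odd `χ'` is
> not conjugate to `χ` then either `χ'(β) = 0` or `χ'(H) = 0`. In either case `χ'(βH) = 0` which implies that if we
> let `β = βH`, [`β ∈ N`]. Furthermore, `β` has the appropriate coefficients since the order of a typical product
> `σ^{2m/p₁} ⋯ σ^{2m/p_t} H` is exactly `p₁ ⋯ p_t`, different for each product. This proves the lemma."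

(`ℚ[G] = ℚ[G]⁺ × ℚ[G]⁻` is White's splitting along the central involution `c`, §4 p. 130; a "submodule" is a
`ℚ[G]`-submodule, i.e. an ideal of the commutative ring `ℚ[G]`, and "every submodule" means every NONZERO one.)

The companion file `DegenerateCMTypesAbelianSporadicSubsets` (namespace `WhiteLenstra`) has White's `β` read
through the character, `whiteFun N χ : x ↦ Σ_{T ⊆ primes(N)} (−1)^{|T|} [χ(x) = ∏_{p∈T} e^{2πi/p}]` (coefficients
`0, ±1`, `β(1) = 1`), and LEMMA 3 only for THE ONE MODULE Theorem 3 needs (the odd right annihilators of `S − cS`,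
via Kubota's Lemma 2); its docstring lists "NOT here: Lemma 3 for an arbitrary `G`-submodule of `ℚ[G]⁻`".  THIS
FILE proves LEMMA 3 AS PRINTED, for EVERY nonzero submodule, in three dresses:

* `exists_mem_ideal_coeff_signs` — for every nonzero ideal `I` of Mathlib's group ring `MonoidAlgebra ℚ G` there
  is `β ∈ I`, `β ≠ 0`, with all coefficients `β.coeff g ∈ {0, 1, −1}` (the restriction to `ℚ[G]⁻` plays no role
  in the proof and is dropped); `exists_mem_ideal_coeff_signs_odd` — the printed case `N ⊆ ℚ[G]⁻`
  (`c·a = −a` on `N`): the element is odd, `β(cg) = −β(g)`.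
* `exists_signs_mem_of_forall_translate_mem` — the tree's function model: every nonzero `ℚ`-subspace of `ℚ^G`
  stable under translations contains `whiteFun |G| χ` for a suitable character `χ` (values `0, ±1`, value `1` at `1`).
* `exists_oddAnnihilator_signs_of_exists_oddAnnihilator` — the companion's §5 instance for an ARBITRARY finite
  set `Φ ⊆ G` and any `ρ ∈ G` (no CM-type hypothesis, no Kubota): a nonzero odd rational annihilator of the
  translates of `Φ` yields one with coefficients `0, ±1`.

## The proof (White's, as finite Fourier analysis on `G`; no Wedderburn decomposition is needed)

Characters `ψ : AddChar (Additive G) ℂ`; for `h : G → ℂ` write `ĥ(ψ) = Σ_x h(x)ψ(x)`.  Fix `0 ≠ f ∈ N` and a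
character `χ` with `Σ_x f(x)χ(x)⁻¹ ≠ 0` (one exists: `exists_sum_mul_inv_char_ne_zero`, dual orthogonality).  CLAIM
(`whiteFun_mem_span_translates`): `β = whiteFun |G| χ` lies in the `ℚ`-span `W` of the translates `x ↦ f(gx)` —
White's "`N ⊗ ℂ ⊇ ⊕_{χ' conj χ} ℂe_{χ'}`" and "`χ'(βH) = 0` for `χ'` not conjugate".  If not, a `ℚ`-linear functional
`c` on `ℚ^G` kills `W` but not `β` (`Submodule.exists_dual_map_eq_bot_of_notMem` — the descent "`N` is defined over
`ℚ`").  §1: killing all translates of `f` means `ĉ(ψ̄)·f̂(ψ) = 0` for every `ψ`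
(`sum_mul_inv_char_mul_sum_mul_char_eq_zero`), and Parseval `|G|·Σ_x c(x)β(x) = Σ_ψ ĉ(ψ̄)β̂(ψ)`
(`card_mul_sum_mul_eq_sum_inv_char_mul_char`) produces a `ψ` with `ĉ(ψ̄) ≠ 0 ≠ β̂(ψ)`, whence `f̂(ψ) = 0`.  §2:
`N·β̂(ψ) = Σ_{j<N} ∏_{p|N}(1 − ζ_p^{−j})·Σ_x χ(x)ʲψ(x)` (`card_mul_sum_whiteFun_mul_char_eq`), and the product
vanishes unless `(j, N) = 1` (companion `prod_one_sub_inv_zeta_pow_eq_zero`), so `β̂(ψ) ≠ 0` forces `ψ = χ^{−j}`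
with `(j, N) = 1` — "`χ` and `χᵗ` are conjugate ⟺ `(t, 2m) = 1`".  §3: `f̂(χ^{−j}) = Σ_x f(x)(χ(x)⁻¹)ʲ ≠ 0` because
`f` has RATIONAL coefficients: a rational combination of `N`-th roots of unity vanishes together with its Galois
conjugates (`sum_mul_pow_eq_zero_of_coprime`, the cyclotomic polynomial being the minimal polynomial of
`e^{2πi/N}`; `sum_mul_pow_ne_zero_of_coprime`).  Contradiction.  §4 assembles Lemma 3; §5 is the group-ring dress
(`(single g⁻¹ 1 * a).coeff x = a.coeff (gx)`: left ideals of `ℚ[G]` ↔ translation-stable subspaces of `ℚ^G`).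

Everything is PROVED (no definition, no named fact, no `sorry`).  NOT here: non-abelian `G` (false as stated:
White's Theorem 4); the companion's count `|{β = 1}| = 2^{ω(N)−1}|ker χ|` is `WhiteLenstra.card_whiteSet`.

## References

* [White1993SporadicCycles] S. P. White, Compositio Math. 88 (1993) 123–142, §4 Lemma 3 (p. 131), §4 p. 130
  (`ℚ[G] = ℚ[G]⁺ × ℚ[G]⁻`, right annihilators of `S − cS`).
* [Gordon1999HodgeAVSurvey] B. B. Gordon, *A survey of the Hodge conjecture for abelian varieties*, 9.2.2 ([B.138]).
* [CeccherinisilbersteScarabottiTolli2018] T. Ceccherini-Silberstein, F. Scarabotti, F. Tolli, *Discrete Harmonic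
  Analysis*, CUP 2018 (held text, pp. 57–59): Prop. 2.3.5 (2.13) (dual orthogonality), Thm 2.4.2 (Fourier inversion),
  Thm 2.4.3 (Parseval), Prop. 2.4.6 (iv) (`(f₁ ∗ f₂)^ = f̂₁ f̂₂`) — the finite Fourier analysis of §1.

## Provenance

Cell `pub-hodgecm2` (COR-CM), literature seat `lit-deligne-3` gen 47 (claim WHITE-LEMMA3-GENERAL; count-neutral).
-/

set_option autoImplicit false

noncomputable section

open scoped BigOperators
open Polynomial

namespace Literature.NumberTheory.ComplexMultiplication

namespace WhiteLenstra

/-! ## §1 Finite Fourier analysis on `G`: annihilators of translates, Parseval, a non-orthogonal character -/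

section Fourier

variable {G : Type*} [CommGroup G] [Fintype G]

omit [Fintype G] in
/-- `ψ(xy) = ψ(x)ψ(y)`. [folklore] -/
private theorem char_mul (ψ : AddChar (Additive G) ℂ) (x y : G) :
    ψ (Additive.ofMul (x * y)) = ψ (Additive.ofMul x) * ψ (Additive.ofMul y) := by
  rw [ofMul_mul, AddChar.map_add_eq_mul]

omit [Fintype G] in
/-- `ψ(x⁻¹) = ψ(x)⁻¹`. [folklore] -/
private theorem char_inv (ψ : AddChar (Additive G) ℂ) (x : G) :
    ψ (Additive.ofMul x⁻¹) = (ψ (Additive.ofMul x))⁻¹ := by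
  rw [ofMul_inv, AddChar.map_neg_eq_inv]

omit [Fintype G] in
/-- `ψ(x) ≠ 0`. [folklore] -/
private theorem char_ne_zero (ψ : AddChar (Additive G) ℂ) (x : G) : ψ (Additive.ofMul x) ≠ 0 := by
  intro h
  have h1 := char_mul ψ x⁻¹ x
  rw [inv_mul_cancel, ofMul_one, AddChar.map_zero_eq_one, h, mul_zero] at h1
  exact one_ne_zero h1

/-- `χ(x)^{|G|} = 1`. [folklore] -/
private theorem char_pow_card_eq_one (χ : AddChar (Additive G) ℂ) (x : G) :
    χ (Additive.ofMul x) ^ Fintype.card G = 1 := by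
  rw [← AddChar.map_nsmul_eq_pow, ← ofMul_pow, pow_card_eq_one, ofMul_one, AddChar.map_zero_eq_one]

/-- **A functional killing every translate of `f` is Fourier-orthogonal to `f`: `ĉ(ψ̄)·f̂(ψ) = 0`.**  If
`Σ_x c(x) f(gx) = 0` for every `g ∈ G`, then `(Σ_x c(x)ψ(x)⁻¹)(Σ_y f(y)ψ(y)) = Σ_g ψ(g)·Σ_x c(x)f(gx) = 0` for every
character `ψ` (substitute `y = gx`).  This is the half of "`N ⊗ ℂ = ⊕ ℂe_χ` over the characters occurring in `N`"
that the proof of Lemma 3 uses; it is the Fourier transform of a convolution, `(f₁ ∗ f₂)^ = f̂₁·f̂₂`.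
[cite: White1993SporadicCycles, §4 Lemma 3 (proof)] [cite: CeccherinisilbersteScarabottiTolli2018, Prop. 2.4.6 (iv)] -/
theorem sum_mul_inv_char_mul_sum_mul_char_eq_zero {c f : G → ℂ}
    (h : ∀ g : G, ∑ x, c x * f (g * x) = 0) (ψ : AddChar (Additive G) ℂ) :
    (∑ x, c x * (ψ (Additive.ofMul x))⁻¹) * ∑ y, f y * ψ (Additive.ofMul y) = 0 := by
  calc (∑ x, c x * (ψ (Additive.ofMul x))⁻¹) * ∑ y, f y * ψ (Additive.ofMul y)
      = ∑ x, ∑ y, c x * (ψ (Additive.ofMul x))⁻¹ * (f y * ψ (Additive.ofMul y)) :=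
        Finset.sum_mul_sum _ _ _ _
    _ = ∑ x, ∑ g, c x * (ψ (Additive.ofMul x))⁻¹ * (f (g * x) * ψ (Additive.ofMul (g * x))) := by
        refine Finset.sum_congr rfl fun x _ => ?_
        exact (Fintype.sum_equiv (Equiv.mulRight x)
          (fun g => c x * (ψ (Additive.ofMul x))⁻¹ * (f (g * x) * ψ (Additive.ofMul (g * x))))
          (fun y => c x * (ψ (Additive.ofMul x))⁻¹ * (f y * ψ (Additive.ofMul y))) fun g => rfl).symm
    _ = ∑ x, ∑ g, ψ (Additive.ofMul g) * (c x * f (g * x)) := by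
        refine Finset.sum_congr rfl fun x _ => Finset.sum_congr rfl fun g _ => ?_
        rw [char_mul]
        calc c x * (ψ (Additive.ofMul x))⁻¹ * (f (g * x) * (ψ (Additive.ofMul g) * ψ (Additive.ofMul x)))
            = ψ (Additive.ofMul g) * (c x * f (g * x)) *
                ((ψ (Additive.ofMul x))⁻¹ * ψ (Additive.ofMul x)) := by ring
          _ = ψ (Additive.ofMul g) * (c x * f (g * x)) := by
                rw [inv_mul_cancel₀ (char_ne_zero ψ x), mul_one]
    _ = ∑ g, ψ (Additive.ofMul g) * ∑ x, c x * f (g * x) := by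
        rw [Finset.sum_comm]
        exact Finset.sum_congr rfl fun g _ => (Finset.mul_sum _ _ _).symm
    _ = 0 := Finset.sum_eq_zero fun g _ => by rw [h g, mul_zero]

/-- Dual orthogonality in the form used: `Σ_ψ ψ(x)⁻¹ψ(y) = |G|·[x = y]` ("`Σ_χ χ(x)χ(y)‾ = |A| δ_{x,y}`", (2.13)).
[cite: CeccherinisilbersteScarabottiTolli2018, Prop. 2.3.5 (2.13)] -/
private theorem sum_inv_char_mul_char_eq_ite [DecidableEq G] (x y : G) :
    ∑ ψ : AddChar (Additive G) ℂ, (ψ (Additive.ofMul x))⁻¹ * ψ (Additive.ofMul y) =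
      if x = y then (Fintype.card G : ℂ) else 0 := by
  classical
  have h := AddChar.sum_apply_eq_ite (α := Additive G) (Additive.ofMul (x⁻¹ * y))
  have hc : Fintype.card (Additive G) = Fintype.card G := Fintype.card_congr Additive.toMul
  simp_rw [← char_inv, ← char_mul]
  rw [h, hc]
  by_cases hxy : x = y
  · subst hxy
    rw [inv_mul_cancel, ofMul_one, if_pos rfl, if_pos rfl]
  · rw [if_neg hxy, if_neg]
    rw [ofMul_eq_zero, inv_mul_eq_one]
    exact hxy

/-- **Parseval on `G`**: `|G|·Σ_x c(x)β(x) = Σ_ψ ĉ(ψ̄)·β̂(ψ) = Σ_ψ (Σ_x c(x)ψ(x)⁻¹)(Σ_y β(y)ψ(y))` ("`⟨f̂, ĝ⟩ =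
|A|⟨f, g⟩`", proved from (2.13) exactly as printed) — so a functional that does not kill `β` shares a character with `β̂`.
[cite: CeccherinisilbersteScarabottiTolli2018, Thm 2.4.3 (Parseval formula)] -/
theorem card_mul_sum_mul_eq_sum_inv_char_mul_char (c β : G → ℂ) :
    (Fintype.card G : ℂ) * ∑ x, c x * β x =
      ∑ ψ : AddChar (Additive G) ℂ, (∑ x, c x * (ψ (Additive.ofMul x))⁻¹) * ∑ y, β y * ψ (Additive.ofMul y) := by
  classical
  symm
  calc ∑ ψ : AddChar (Additive G) ℂ, (∑ x, c x * (ψ (Additive.ofMul x))⁻¹) * ∑ y, β y * ψ (Additive.ofMul y)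
      = ∑ ψ : AddChar (Additive G) ℂ, ∑ x, ∑ y,
          c x * β y * ((ψ (Additive.ofMul x))⁻¹ * ψ (Additive.ofMul y)) := by
        refine Finset.sum_congr rfl fun ψ _ => ?_
        rw [Finset.sum_mul_sum]
        exact Finset.sum_congr rfl fun x _ => Finset.sum_congr rfl fun y _ => by ring
    _ = ∑ x, ∑ y, ∑ ψ : AddChar (Additive G) ℂ,
          c x * β y * ((ψ (Additive.ofMul x))⁻¹ * ψ (Additive.ofMul y)) := by
        rw [Finset.sum_comm]
        exact Finset.sum_congr rfl fun x _ => Finset.sum_comm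
    _ = ∑ x, ∑ y, c x * β y * (if x = y then (Fintype.card G : ℂ) else 0) := by
        refine Finset.sum_congr rfl fun x _ => Finset.sum_congr rfl fun y _ => ?_
        rw [← Finset.mul_sum, sum_inv_char_mul_char_eq_ite]
    _ = ∑ x, c x * β x * (Fintype.card G : ℂ) := by
        refine Finset.sum_congr rfl fun x _ => ?_
        simp_rw [mul_ite, mul_zero]
        rw [Finset.sum_ite_eq Finset.univ x, if_pos (Finset.mem_univ x)]
    _ = (Fintype.card G : ℂ) * ∑ x, c x * β x := by
        rw [Finset.mul_sum]
        exact Finset.sum_congr rfl fun x _ => by ring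

/-- **A nonzero function is not orthogonal to every character**: `f ≠ 0 ⟹ Σ_x f(x)χ(x)⁻¹ ≠ 0` for some `χ`
(Fourier inversion `|G|·f(y) = Σ_ψ ψ(y)·Σ_x f(x)ψ(x)⁻¹`, "`f = |A|⁻¹ Σ_χ f̂(χ)χ`") — the character "occurring in `N`"
of White's proof. [cite: CeccherinisilbersteScarabottiTolli2018, Thm 2.4.2 (Fourier inversion formula)]
[cite: White1993SporadicCycles, §4 Lemma 3 (proof)] -/
theorem exists_sum_mul_inv_char_ne_zero {f : G → ℂ} (hf : f ≠ 0) :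
    ∃ χ : AddChar (Additive G) ℂ, ∑ x, f x * (χ (Additive.ofMul x))⁻¹ ≠ 0 := by
  classical
  by_contra hall
  push Not at hall
  apply hf
  funext y
  -- `Σ_ψ ψ(y)·Σ_x f(x)ψ(x)⁻¹ = |G| f(y)`
  have key : ∑ ψ : AddChar (Additive G) ℂ, ψ (Additive.ofMul y) * ∑ x, f x * (ψ (Additive.ofMul x))⁻¹ =
      (Fintype.card G : ℂ) * f y := by
    calc ∑ ψ : AddChar (Additive G) ℂ, ψ (Additive.ofMul y) * ∑ x, f x * (ψ (Additive.ofMul x))⁻¹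
        = ∑ ψ : AddChar (Additive G) ℂ, ∑ x, f x * ((ψ (Additive.ofMul x))⁻¹ * ψ (Additive.ofMul y)) := by
          refine Finset.sum_congr rfl fun ψ _ => ?_
          rw [Finset.mul_sum]
          exact Finset.sum_congr rfl fun x _ => by ring
      _ = ∑ x, f x * ∑ ψ : AddChar (Additive G) ℂ, (ψ (Additive.ofMul x))⁻¹ * ψ (Additive.ofMul y) := by
          rw [Finset.sum_comm]
          exact Finset.sum_congr rfl fun x _ => (Finset.mul_sum _ _ _).symm
      _ = ∑ x, f x * (if x = y then (Fintype.card G : ℂ) else 0) :=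
          Finset.sum_congr rfl fun x _ => by rw [sum_inv_char_mul_char_eq_ite]
      _ = (Fintype.card G : ℂ) * f y := by
          simp_rw [mul_ite, mul_zero]
          rw [Finset.sum_ite_eq' Finset.univ y, if_pos (Finset.mem_univ y), mul_comm]
  rw [Finset.sum_eq_zero fun ψ _ => by rw [hall ψ, mul_zero]] at key
  show f y = 0
  exact (mul_eq_zero.1 key.symm).resolve_left (Nat.cast_ne_zero.2 Fintype.card_ne_zero)

end Fourier

/-! ## §2 The characters occurring in `β̂`: only the conjugates `χ^{−j}`, `(j, N) = 1` -/

section Support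

variable {G : Type*} [CommGroup G] [Fintype G]

/-- `z_T^N = 1` for `T ⊆ primes(N)`. [folklore] -/
private theorem rootProd_pow_eq_one_of_subset {N : ℕ} {T : Finset ℕ} (hT : T ⊆ N.primeFactors) :
    rootProd T ^ N = 1 := by
  unfold rootProd
  rw [← Finset.prod_pow]
  exact Finset.prod_eq_one fun p hp =>
    (zeta_pow_eq_one_iff (Nat.prime_of_mem_primeFactors (hT hp)).ne_zero N).2
      (Nat.dvd_of_mem_primeFactors (hT hp))

/-- Geometric sums over `μ_N`: for `u^N = 1`, `Σ_{j<N} u^j = N·[u = 1]`. [folklore] -/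
private theorem geom_sum_of_pow_eq_one' {u : ℂ} {N : ℕ} (hu : u ^ N = 1) :
    ∑ j ∈ Finset.range N, u ^ j = if u = 1 then (N : ℂ) else 0 := by
  by_cases h1 : u = 1
  · rw [if_pos h1, h1]
    simp
  · rw [if_neg h1]
    have h := geom_sum_mul u N
    rw [hu, sub_self] at h
    exact (mul_eq_zero.1 h).resolve_right (sub_ne_zero.2 h1)

/-- **The Fourier transform of White's `β`**: for `χ(x)^N = 1` on `G` (`N > 0`) and any character `ψ`,
`N·Σ_x β(x)ψ(x) = Σ_{j<N} ∏_{p|N}(1 − ζ_p^{−j}) · Σ_x χ(x)ʲψ(x)` (expand `N·[χ(x) = z_T] = Σ_{j<N} (χ(x)z_T⁻¹)ʲ` and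
`Σ_T (−1)^{|T|} z_T^{−j} = ∏_{p|N}(1 − ζ_p^{−j})`) — White's "`χ'(β) = ∏_{p|2m}(1 − χ'(σ^{2m/p}))`, and "`χ'(βH) = 0`"
unless `χ'` is trivial on `H`. [cite: White1993SporadicCycles, §4 Lemma 3 (proof)] -/
theorem card_mul_sum_whiteFun_mul_char_eq {N : ℕ} (χ ψ : AddChar (Additive G) ℂ)
    (hχN : ∀ x : G, χ (Additive.ofMul x) ^ N = 1) :
    (N : ℂ) * ∑ x, (whiteFun N χ x : ℂ) * ψ (Additive.ofMul x) =
      ∑ j ∈ Finset.range N, (∏ p ∈ N.primeFactors, (1 - (zeta p ^ j)⁻¹)) *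
        ∑ x, χ (Additive.ofMul x) ^ j * ψ (Additive.ofMul x) := by
  classical
  set P := N.primeFactors with hPdef
  have hz0 : ∀ T : Finset ℕ, rootProd T ≠ 0 := fun T =>
    Finset.prod_ne_zero_iff.2 fun p _ => Complex.exp_ne_zero _
  -- Fourier inversion on `μ_N`: `N·[χ x = z_T] = Σ_{j<N} (χ x)^j (z_T^j)⁻¹`
  have hfour : ∀ x : G, ∀ T ∈ P.powerset,
      (N : ℂ) * (if χ (Additive.ofMul x) = rootProd T then (1 : ℂ) else 0) =
        ∑ j ∈ Finset.range N, χ (Additive.ofMul x) ^ j * (rootProd T ^ j)⁻¹ := by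
    intro x T hT
    have hu : (χ (Additive.ofMul x) * (rootProd T)⁻¹) ^ N = 1 := by
      rw [mul_pow, inv_pow, hχN x, rootProd_pow_eq_one_of_subset (Finset.mem_powerset.1 hT), inv_one, mul_one]
    have h := geom_sum_of_pow_eq_one' hu
    simp only [mul_inv_eq_one₀ (hz0 T)] at h
    simp_rw [← inv_pow, ← mul_pow]
    rw [h]
    split_ifs <;> simp
  -- the cast of `β`
  have hβ : ∀ x : G, ((whiteFun N χ x : ℚ) : ℂ) =
      ∑ T ∈ P.powerset, (-1 : ℂ) ^ T.card * (if χ (Additive.ofMul x) = rootProd T then (1 : ℂ) else 0) := by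
    intro x
    unfold whiteFun
    push_cast
    refine Finset.sum_congr rfl fun T _ => ?_
    split_ifs <;> simp
  calc (N : ℂ) * ∑ x, (whiteFun N χ x : ℂ) * ψ (Additive.ofMul x)
      = ∑ x, ∑ T ∈ P.powerset, (-1 : ℂ) ^ T.card *
          ((N : ℂ) * (if χ (Additive.ofMul x) = rootProd T then (1 : ℂ) else 0)) * ψ (Additive.ofMul x) := by
        rw [Finset.mul_sum]
        refine Finset.sum_congr rfl fun x _ => ?_
        rw [hβ x, Finset.sum_mul, Finset.mul_sum]
        exact Finset.sum_congr rfl fun T _ => by ring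
    _ = ∑ x, ∑ T ∈ P.powerset, ∑ j ∈ Finset.range N,
          (-1 : ℂ) ^ T.card * (rootProd T ^ j)⁻¹ * (χ (Additive.ofMul x) ^ j * ψ (Additive.ofMul x)) := by
        refine Finset.sum_congr rfl fun x _ => Finset.sum_congr rfl fun T hT => ?_
        rw [hfour x T hT, Finset.mul_sum, Finset.sum_mul]
        exact Finset.sum_congr rfl fun j _ => by ring
    _ = ∑ j ∈ Finset.range N, ∑ T ∈ P.powerset, ∑ x,
          (-1 : ℂ) ^ T.card * (rootProd T ^ j)⁻¹ * (χ (Additive.ofMul x) ^ j * ψ (Additive.ofMul x)) := by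
        calc ∑ x, ∑ T ∈ P.powerset, ∑ j ∈ Finset.range N,
              (-1 : ℂ) ^ T.card * (rootProd T ^ j)⁻¹ * (χ (Additive.ofMul x) ^ j * ψ (Additive.ofMul x))
            = ∑ x, ∑ j ∈ Finset.range N, ∑ T ∈ P.powerset,
              (-1 : ℂ) ^ T.card * (rootProd T ^ j)⁻¹ * (χ (Additive.ofMul x) ^ j * ψ (Additive.ofMul x)) :=
              Finset.sum_congr rfl fun x _ => Finset.sum_comm
          _ = ∑ j ∈ Finset.range N, ∑ x, ∑ T ∈ P.powerset,
              (-1 : ℂ) ^ T.card * (rootProd T ^ j)⁻¹ * (χ (Additive.ofMul x) ^ j * ψ (Additive.ofMul x)) :=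
              Finset.sum_comm
          _ = ∑ j ∈ Finset.range N, ∑ T ∈ P.powerset, ∑ x,
              (-1 : ℂ) ^ T.card * (rootProd T ^ j)⁻¹ * (χ (Additive.ofMul x) ^ j * ψ (Additive.ofMul x)) :=
              Finset.sum_congr rfl fun j _ => Finset.sum_comm
    _ = ∑ j ∈ Finset.range N, (∏ p ∈ P, (1 - (zeta p ^ j)⁻¹)) *
          ∑ x, χ (Additive.ofMul x) ^ j * ψ (Additive.ofMul x) := by
        refine Finset.sum_congr rfl fun j _ => ?_
        rw [← sum_neg_one_pow_mul_inv_rootProd_pow P j, Finset.sum_mul]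
        exact Finset.sum_congr rfl fun T _ => (Finset.mul_sum _ _ _).symm

/-- **"`χ` and `χᵗ` are conjugate ⟺ `(t, 2m) = 1`; `χ'(βH) = 0` otherwise"**: if `β̂(ψ) = Σ_x β(x)ψ(x) ≠ 0` then
`ψ = χ^{−j}` for some `j < N` prime to `N` (the factor `∏_{p|N}(1 − ζ_p^{−j})` vanishes for `(j, N) > 1`, and
`Σ_x χ(x)ʲψ(x) ≠ 0` forces the character `χʲψ` to be trivial). [cite: White1993SporadicCycles, §4 Lemma 3 (proof)] -/
theorem exists_coprime_of_sum_whiteFun_mul_char_ne_zero {N : ℕ} (hN : 0 < N) (χ ψ : AddChar (Additive G) ℂ)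
    (hχN : ∀ x : G, χ (Additive.ofMul x) ^ N = 1)
    (hne : ∑ x, (whiteFun N χ x : ℂ) * ψ (Additive.ofMul x) ≠ 0) :
    ∃ j < N, j.Coprime N ∧ ∀ x : G, ψ (Additive.ofMul x) = (χ (Additive.ofMul x) ^ j)⁻¹ := by
  classical
  have hne' : (N : ℂ) * ∑ x, (whiteFun N χ x : ℂ) * ψ (Additive.ofMul x) ≠ 0 :=
    mul_ne_zero (Nat.cast_ne_zero.2 hN.ne') hne
  rw [card_mul_sum_whiteFun_mul_char_eq χ ψ hχN] at hne'
  obtain ⟨j, hj, hjne⟩ := Finset.exists_ne_zero_of_sum_ne_zero hne'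
  have hcop : j.Coprime N := by
    by_contra hj'
    rw [prod_one_sub_inv_zeta_pow_eq_zero hN.ne' hj', zero_mul] at hjne
    exact hjne rfl
  refine ⟨j, Finset.mem_range.1 hj, hcop, fun x => ?_⟩
  have hsum : ∑ x, χ (Additive.ofMul x) ^ j * ψ (Additive.ofMul x) ≠ 0 := right_ne_zero_of_mul hjne
  -- the character `jχ + ψ` has a non-zero sum, hence is trivial
  have hchar : j • χ + ψ = 0 := by
    by_contra h0
    apply hsum
    have h1 := AddChar.sum_eq_zero_iff_ne_zero.2 h0
    rw [← h1]
    exact Fintype.sum_equiv Additive.ofMul _ _ fun y => by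
      rw [AddChar.add_apply, AddChar.nsmul_apply]
  have h2 := DFunLike.congr_fun hchar (Additive.ofMul x)
  rw [AddChar.add_apply, AddChar.nsmul_apply, AddChar.zero_apply] at h2
  exact eq_inv_of_mul_eq_one_right h2

end Support

/-! ## §3 Galois conjugates of a RATIONAL combination of roots of unity ("`N` is defined over `ℚ`") -/

section Conjugates

/-- **A vanishing rational combination of `N`-th roots of unity vanishes with all its conjugates**: if
`u_i^N = 1`, `a_i ∈ ℚ` and `Σ a_i u_i = 0`, then `Σ a_i u_iᵗ = 0` for every `t` prime to `N` (the cyclotomic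
polynomial `Φ_N = minpoly_ℚ(e^{2πi/N})` divides `Σ a_i X^{e_i}`, `u_i = ζ^{e_i}`, and `ζᵗ` is another root) — the
weighted form of the companion's `sum_pow_eq_zero_of_coprime`, i.e. White's "Because `N` is defined over `ℚ`,
`N ⊗ ℂ ⊇ ⊕_{χ' conjugate to χ} ℂe_{χ'}`". [cite: White1993SporadicCycles, §4 Lemma 3 (proof)] -/
theorem sum_mul_pow_eq_zero_of_coprime {ι : Type*} (s : Finset ι) (a : ι → ℚ) (u : ι → ℂ) {N : ℕ}
    (hN : 0 < N) (hu : ∀ i ∈ s, u i ^ N = 1) (h0 : ∑ i ∈ s, (a i : ℂ) * u i = 0) {t : ℕ}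
    (ht : t.Coprime N) : ∑ i ∈ s, (a i : ℂ) * u i ^ t = 0 := by
  classical
  haveI : NeZero N := ⟨hN.ne'⟩
  have hζ := isPrimitiveRoot_zeta hN.ne'
  have hex : ∀ i ∈ s, ∃ e : ℕ, zeta N ^ e = u i := fun i hi => by
    obtain ⟨e, -, he⟩ := hζ.eq_pow_of_pow_eq_one (hu i hi)
    exact ⟨e, he⟩
  choose! e he using hex
  set P : ℚ[X] := ∑ i ∈ s, C (a i) * X ^ e i with hP
  have haeval : ∀ z : ℂ, aeval z P = ∑ i ∈ s, (a i : ℂ) * z ^ e i := fun z => by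
    simp only [hP, map_sum, map_mul, map_pow, aeval_X, aeval_C, eq_ratCast]
  have h1 : aeval (zeta N) P = 0 := by
    rw [haeval, ← h0]
    exact Finset.sum_congr rfl fun i hi => by rw [he i hi]
  have hdvd : minpoly ℚ (zeta N) ∣ P := minpoly.dvd ℚ (zeta N) h1
  have hroot : aeval (zeta N ^ t) (minpoly ℚ (zeta N)) = 0 := by
    rw [← cyclotomic_eq_minpoly_rat hζ hN, aeval_def, ← eval_map, map_cyclotomic, ← IsRoot.def,
      isRoot_cyclotomic_iff]
    exact hζ.pow_of_coprime t ht
  have h2 := aeval_eq_zero_of_dvd_aeval_eq_zero hdvd hroot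
  rw [haeval] at h2
  rw [← h2]
  refine Finset.sum_congr rfl fun i hi => ?_
  rw [← he i hi, pow_right_comm]

/-- **Non-vanishing is Galois-stable too**: under the same hypotheses `Σ a_i u_i ≠ 0 ⟹ Σ a_i u_iᵗ ≠ 0` for
`(t, N) = 1` (apply the lemma to `u_iᵗ` and an inverse `t'` of `t` modulo `N`). [cite: White1993SporadicCycles, §4 Lemma 3 (proof)] -/
theorem sum_mul_pow_ne_zero_of_coprime {ι : Type*} (s : Finset ι) (a : ι → ℚ) (u : ι → ℂ) {N : ℕ}
    (hN : 0 < N) (hu : ∀ i ∈ s, u i ^ N = 1) (hne : ∑ i ∈ s, (a i : ℂ) * u i ≠ 0) {t : ℕ}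
    (ht : t.Coprime N) : ∑ i ∈ s, (a i : ℂ) * u i ^ t ≠ 0 := by
  intro h0
  apply hne
  rcases Nat.lt_or_ge 1 N with h1 | h1
  · obtain ⟨m, -, hm⟩ := Nat.exists_mul_mod_eq_one_of_coprime ht h1
    have hmcop : m.Coprime N := by
      refine Nat.coprime_of_mul_modEq_one t ?_
      show m * t % N = 1 % N
      rw [mul_comm, hm, Nat.mod_eq_of_lt h1]
    have hv : ∀ i ∈ s, (u i ^ t) ^ N = 1 := fun i hi => by
      rw [← pow_mul, mul_comm, pow_mul, hu i hi, one_pow]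
    have h2 := sum_mul_pow_eq_zero_of_coprime s a (fun i => u i ^ t) hN hv h0 hmcop
    rw [← h2]
    refine Finset.sum_congr rfl fun i hi => ?_
    show (a i : ℂ) * u i = (a i : ℂ) * (u i ^ t) ^ m
    rw [← pow_mul, ← Nat.div_add_mod (t * m) N, hm, pow_add, pow_mul, hu i hi, one_pow, one_mul, pow_one]
  · have hN1 : N = 1 := le_antisymm h1 hN
    rw [← h0]
    refine Finset.sum_congr rfl fun i hi => ?_
    have h3 := hu i hi
    rw [hN1, pow_one] at h3
    rw [h3, one_pow]

end Conjugates

/-! ## §4 LEMMA 3: White's `β` lies in the span of the translates of any `f` with `f̂(χ̄) ≠ 0` -/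

section Lemma3

variable {G : Type*} [CommGroup G] [Fintype G]

omit [CommGroup G] in
/-- A linear functional on `ℚ^G` is `h ↦ Σ_x c(x)h(x)` with `c(x) = φ(δ_x)`. [folklore] -/
private theorem dual_apply_eq_sum [DecidableEq G] (φ : Module.Dual ℚ (G → ℚ)) (h : G → ℚ) :
    φ h = ∑ x, φ (Pi.single x 1) * h x := by
  conv_lhs => rw [← Finset.univ_sum_single h]
  rw [map_sum]
  refine Finset.sum_congr rfl fun x _ => ?_
  have h1 : (Pi.single x (h x) : G → ℚ) = h x • (Pi.single x (1 : ℚ) : G → ℚ) := by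
    rw [← Pi.single_smul', smul_eq_mul, mul_one]
  rw [h1, map_smul, smul_eq_mul, mul_comm]

/-- **The heart of LEMMA 3.**  For `f : G → ℚ` and a character `χ` with `Σ_x f(x)χ(x)⁻¹ ≠ 0`, White's
`β = whiteFun |G| χ` (coefficients `0, ±1`, `β(1) = 1`) is a RATIONAL combination of the translates `x ↦ f(gx)`,
`g ∈ G` — "`N ⊗ ℂ ⊇ ⊕_{χ' conjugate to χ} ℂ e_{χ'}` … `χ'(βH) = 0` [for the other `χ'`], which implies `β ∈ N`".
Proof: a functional `c` killing the translates but not `β` (`ℚ`-descent) would give, by Parseval, a character `ψ`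
with `ĉ(ψ̄) ≠ 0 ≠ β̂(ψ)`, hence `f̂(ψ) = 0` (§1) with `ψ = χ^{−j}`, `(j, |G|) = 1` (§2) — contradicting §3.
[cite: White1993SporadicCycles, §4 Lemma 3] -/
theorem whiteFun_mem_span_translates {f : G → ℚ} {χ : AddChar (Additive G) ℂ}
    (hχ : ∑ x, (f x : ℂ) * (χ (Additive.ofMul x))⁻¹ ≠ 0) :
    whiteFun (Fintype.card G) χ ∈ Submodule.span ℚ (Set.range fun g : G => fun x => f (g * x)) := by
  classical
  by_contra hmem
  obtain ⟨φ, hφβ, hφW⟩ := Submodule.exists_dual_map_eq_bot_of_notMem hmem inferInstance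
  -- `φ` kills the translates
  have hφt : ∀ g : G, φ (fun x => f (g * x)) = 0 := fun g => by
    have h1 : φ (fun x => f (g * x)) ∈
        (Submodule.span ℚ (Set.range fun g : G => fun x => f (g * x))).map φ :=
      Submodule.mem_map_of_mem (Submodule.subset_span ⟨g, rfl⟩)
    rw [hφW] at h1
    exact (Submodule.mem_bot ℚ).1 h1
  set c : G → ℚ := fun x => φ (Pi.single x 1) with hc
  have hann : ∀ g : G, ∑ x, c x * f (g * x) = 0 := fun g => by
    rw [← dual_apply_eq_sum φ (fun x => f (g * x))]
    exact hφt g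
  have hβ : ∑ x, c x * whiteFun (Fintype.card G) χ x ≠ 0 := by
    rw [← dual_apply_eq_sum φ]
    exact hφβ
  -- pass to `ℂ`
  have hannC : ∀ g : G, ∑ x, (c x : ℂ) * ((f (g * x) : ℚ) : ℂ) = 0 := fun g => by exact_mod_cast hann g
  have hβC : ∑ x, (c x : ℂ) * ((whiteFun (Fintype.card G) χ x : ℚ) : ℂ) ≠ 0 := by exact_mod_cast hβ
  -- Parseval: a character `ψ` seen by both `c` and `β`
  have hP := card_mul_sum_mul_eq_sum_inv_char_mul_char (fun x => (c x : ℂ))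
    (fun x => ((whiteFun (Fintype.card G) χ x : ℚ) : ℂ))
  have hne : (Fintype.card G : ℂ) * ∑ x, (c x : ℂ) * ((whiteFun (Fintype.card G) χ x : ℚ) : ℂ) ≠ 0 :=
    mul_ne_zero (Nat.cast_ne_zero.2 Fintype.card_ne_zero) hβC
  rw [hP] at hne
  obtain ⟨ψ, -, hψ⟩ := Finset.exists_ne_zero_of_sum_ne_zero hne
  have hcψ : ∑ x, (c x : ℂ) * (ψ (Additive.ofMul x))⁻¹ ≠ 0 := left_ne_zero_of_mul hψ
  have hβψ : ∑ y, ((whiteFun (Fintype.card G) χ y : ℚ) : ℂ) * ψ (Additive.ofMul y) ≠ 0 :=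
    right_ne_zero_of_mul hψ
  -- §1: `f̂(ψ) = 0`
  have hfψ : ∑ y, ((f y : ℚ) : ℂ) * ψ (Additive.ofMul y) = 0 := by
    have h1 := sum_mul_inv_char_mul_sum_mul_char_eq_zero (c := fun x => (c x : ℂ))
      (f := fun y => ((f y : ℚ) : ℂ)) hannC ψ
    exact (mul_eq_zero.1 h1).resolve_left hcψ
  -- §2: `ψ = χ^{-j}`, `(j, |G|) = 1`
  have hχN : ∀ x : G, χ (Additive.ofMul x) ^ Fintype.card G = 1 := char_pow_card_eq_one χ
  obtain ⟨j, -, hj, hψχ⟩ :=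
    exists_coprime_of_sum_whiteFun_mul_char_ne_zero Fintype.card_pos χ ψ hχN hβψ
  -- §3: `f̂(χ^{-j}) ≠ 0`
  have hu : ∀ y ∈ (Finset.univ : Finset G), ((χ (Additive.ofMul y))⁻¹) ^ Fintype.card G = 1 := fun y _ => by
    rw [inv_pow, hχN y, inv_one]
  have hgal := sum_mul_pow_ne_zero_of_coprime Finset.univ f (fun y => (χ (Additive.ofMul y))⁻¹)
    Fintype.card_pos hu hχ hj
  apply hgal
  refine (Finset.sum_congr rfl fun y _ => ?_).trans hfψ
  show ((f y : ℚ) : ℂ) * ((χ (Additive.ofMul y))⁻¹) ^ j = ((f y : ℚ) : ℂ) * ψ (Additive.ofMul y)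
  rw [hψχ y, inv_pow]

/-- **LEMMA 3 (White 1993), function model: every nonzero translation-stable `ℚ`-subspace of `ℚ^G` (= submodule of
`ℚ[G]`, `G` finite abelian) contains White's `β = whiteFun |G| χ` for some character `χ`** — an element with
coefficients `0, ±1` and `β(1) = 1`. [cite: White1993SporadicCycles, §4 Lemma 3] -/
theorem exists_whiteFun_mem_of_forall_translate_mem (N : Submodule ℚ (G → ℚ))
    (hinv : ∀ f ∈ N, ∀ g : G, (fun x => f (g * x)) ∈ N) (hN : N ≠ ⊥) :
    ∃ χ : AddChar (Additive G) ℂ, whiteFun (Fintype.card G) χ ∈ N := by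
  obtain ⟨f, hfN, hf0⟩ := N.ne_bot_iff.1 hN
  have hfC : (fun x => ((f x : ℚ) : ℂ)) ≠ 0 := by
    intro h
    apply hf0
    funext x
    have h1 := congrFun h x
    simp only [Pi.zero_apply, Rat.cast_eq_zero] at h1
    exact h1
  obtain ⟨χ, hχ⟩ := exists_sum_mul_inv_char_ne_zero hfC
  refine ⟨χ, ?_⟩
  have hle : Submodule.span ℚ (Set.range fun g : G => fun x => f (g * x)) ≤ N :=
    Submodule.span_le.2 (by rintro _ ⟨g, rfl⟩; exact hinv f hfN g)
  exact hle (whiteFun_mem_span_translates hχ)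

/-- **LEMMA 3 (White 1993) AS PRINTED, function model: "every [nonzero] submodule `N` of `ℚ[G]` has a nonzero
element `β` whose coefficients are `0, ±1`"** — here `N` is any nonzero `ℚ`-subspace of `ℚ^G` stable under all
translations `x ↦ gx` (the `ℚ[G]`-submodules of the regular module), and `β(1) = 1`. [cite: White1993SporadicCycles, §4 Lemma 3] -/
theorem exists_signs_mem_of_forall_translate_mem (N : Submodule ℚ (G → ℚ))
    (hinv : ∀ f ∈ N, ∀ g : G, (fun x => f (g * x)) ∈ N) (hN : N ≠ ⊥) :
    ∃ β ∈ N, (∀ x, β x = 0 ∨ β x = 1 ∨ β x = -1) ∧ β ≠ 0 ∧ β 1 = 1 := by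
  obtain ⟨χ, hχ⟩ := exists_whiteFun_mem_of_forall_translate_mem N hinv hN
  refine ⟨whiteFun (Fintype.card G) χ, hχ, whiteFun_mem_signs _ χ, fun h0 => ?_, whiteFun_one _ χ⟩
  have h1 := congrFun h0 1
  rw [whiteFun_one] at h1
  exact one_ne_zero h1

/-- **LEMMA 3 for submodules of `ℚ[G]⁻`** (the printed setting: `N` consists of odd functions, `f(ρx) = −f(x)` for
White's central involution `c = ρ`): the element found is odd. [cite: White1993SporadicCycles, §4 Lemma 3] -/
theorem exists_odd_signs_mem_of_forall_translate_mem (ρ : G) (N : Submodule ℚ (G → ℚ))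
    (hinv : ∀ f ∈ N, ∀ g : G, (fun x => f (g * x)) ∈ N) (hodd : ∀ f ∈ N, ∀ x : G, f (ρ * x) = -f x)
    (hN : N ≠ ⊥) :
    ∃ β ∈ N, (∀ x, β x = 0 ∨ β x = 1 ∨ β x = -1) ∧ β ≠ 0 ∧ β 1 = 1 ∧ ∀ x, β (ρ * x) = -β x := by
  obtain ⟨β, hβN, hs, h0, h1⟩ := exists_signs_mem_of_forall_translate_mem N hinv hN
  exact ⟨β, hβN, hs, h0, h1, hodd β hβN⟩

/-- **The companion's §5 without any CM-type hypothesis.**  For ANY finite `Φ ⊆ G` and any `ρ ∈ G`: if the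
translates `x ↦ [gx ∈ Φ]` have a nonzero odd rational annihilator (`Σ_x c(x)[gx ∈ Φ] = 0` for all `g`, `c(ρx) =
−c(x)`), they have one with coefficients `0, ±1` and value `1` at `1` — LEMMA 3 applied to the module `N` of odd
right annihilators of `S − cS` ("a sporadic cycle on `Aⁿ` would correspond to a right annihilator of `S − cS` in
`ℚ[G]⁻` whose coefficients are `0, ±1, …, ±n`"; compare `IsCMTypeWith.exists_oddAnnihilator_signs_of_exists_oddAnnihilator`,
which needs `S` to be a CM type and goes through Kubota's Lemma 2). [cite: White1993SporadicCycles, §4 Lemma 3 and p. 130] -/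
theorem exists_oddAnnihilator_signs_of_exists_oddAnnihilator (ρ : G) (Φ : Finset G)
    (h : ∃ c : G → ℚ, c ≠ 0 ∧ (∀ x, c (ρ * x) = -c x) ∧
      ∀ g : G, ∑ x, c x * translateInd (Φ : Set G) g x = 0) :
    ∃ β : G → ℚ, (∀ x, β x = 0 ∨ β x = 1 ∨ β x = -1) ∧ β ≠ 0 ∧ β 1 = 1 ∧ (∀ x, β (ρ * x) = -β x) ∧
      ∀ g : G, ∑ x, β x * translateInd (Φ : Set G) g x = 0 := by
  classical
  -- the translates of `𝟙_Φ`
  have htr : ∀ g x : G, translateInd (Φ : Set G) g x = translateInd (Φ : Set G) (1 : G) (g * x) :=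
      fun g x => by
    unfold translateInd
    rw [one_smul, smul_eq_mul]
  -- the module `N` of odd annihilators
  let N : Submodule ℚ (G → ℚ) :=
    { carrier := {c | (∀ x, c (ρ * x) = -c x) ∧ ∀ g : G, ∑ x, c x * translateInd (Φ : Set G) g x = 0}
      add_mem' := by
        rintro a b ⟨ha1, ha2⟩ ⟨hb1, hb2⟩
        refine ⟨fun x => ?_, fun g => ?_⟩
        · simp only [Pi.add_apply, ha1 x, hb1 x]
          ring
        · simp only [Pi.add_apply, add_mul, Finset.sum_add_distrib, ha2 g, hb2 g, add_zero]
      zero_mem' := by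
        refine ⟨fun x => ?_, fun g => ?_⟩
        · simp
        · simp
      smul_mem' := by
        rintro r a ⟨ha1, ha2⟩
        refine ⟨fun x => ?_, fun g => ?_⟩
        · simp only [Pi.smul_apply, smul_eq_mul, ha1 x, mul_neg]
        · simp only [Pi.smul_apply, smul_eq_mul, mul_assoc, ← Finset.mul_sum, ha2 g, mul_zero] }
  have hmem : ∀ c : G → ℚ, c ∈ N ↔
      (∀ x, c (ρ * x) = -c x) ∧ ∀ g : G, ∑ x, c x * translateInd (Φ : Set G) g x = 0 := fun c => Iff.rfl
  have hinv : ∀ f ∈ N, ∀ g : G, (fun x => f (g * x)) ∈ N := by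
    intro f hf g
    rw [hmem] at hf ⊢
    refine ⟨fun x => ?_, fun g' => ?_⟩
    · simp only [mul_left_comm g ρ x, hf.1 (g * x)]
    · -- `Σ_x f(gx)[g'x ∈ Φ] = Σ_y f(y)[g'g⁻¹y ∈ Φ]`
      have h1 := hf.2 (g' * g⁻¹)
      rw [← h1]
      refine Fintype.sum_equiv (Equiv.mulLeft g) _ _ fun x => ?_
      have hgx : g' * g⁻¹ * (g * x) = g' * x := by group
      simp only [Equiv.coe_mulLeft, htr g' x, htr (g' * g⁻¹) (g * x), hgx]
  have hN : N ≠ ⊥ := by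
    obtain ⟨c, hc0, hc1, hc2⟩ := h
    rw [Submodule.ne_bot_iff]
    exact ⟨c, (hmem c).2 ⟨hc1, hc2⟩, hc0⟩
  obtain ⟨β, hβN, hs, h0, h1⟩ := exists_signs_mem_of_forall_translate_mem N hinv hN
  rw [hmem] at hβN
  exact ⟨β, hs, h0, h1, hβN.1, hβN.2⟩

end Lemma3

/-! ## §5 LEMMA 3 in the group ring `ℚ[G] = MonoidAlgebra ℚ G` -/

section GroupRing

open MonoidAlgebra

variable {G : Type*} [CommGroup G] [Fintype G]

/-- **LEMMA 3 (White 1993) in the group ring: for `G` finite abelian, every nonzero ideal `I` of `ℚ[G]` contains a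
nonzero element all of whose coefficients are `0, 1` or `−1`** (indeed White's `βH = H·∏_{p|N}(1 − σ^{N/p})` for a
character `χ` occurring in `I`, `H = ker χ`, `N = [G:H]`; its coefficient at `1` is `1`).  Left ideals of `ℚ[G]`
are the translation-stable subspaces of `ℚ^G` under `a ↦ (g ↦ a.coeff g)` (`(δ_{g⁻¹}·a).coeff x = a.coeff (gx)`).
[cite: White1993SporadicCycles, §4 Lemma 3] -/
theorem exists_mem_ideal_coeff_signs (I : Ideal (MonoidAlgebra ℚ G)) (hI : I ≠ ⊥) :
    ∃ β ∈ I, β ≠ 0 ∧ β.coeff 1 = 1 ∧ ∀ g : G, β.coeff g = 0 ∨ β.coeff g = 1 ∨ β.coeff g = -1 := by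
  classical
  obtain ⟨a, haI, ha0⟩ := I.ne_bot_iff.1 hI
  -- coefficients, as a `ℚ`-linear map to `ℚ^G`
  let L : MonoidAlgebra ℚ G →ₗ[ℚ] (G → ℚ) :=
    (Finsupp.linearEquivFunOnFinite ℚ ℚ G).toLinearMap ∘ₗ (MonoidAlgebra.coeffLinearEquiv ℚ).toLinearMap
  have hL : ∀ b : MonoidAlgebra ℚ G, ∀ x : G, L b x = b.coeff x := fun b x => rfl
  have hLinj : Function.Injective L :=
    (Finsupp.linearEquivFunOnFinite ℚ ℚ G).injective.comp (MonoidAlgebra.coeffLinearEquiv ℚ).injective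
  let N : Submodule ℚ (G → ℚ) := (I.restrictScalars ℚ).map L
  have hinv : ∀ h ∈ N, ∀ g : G, (fun x => h (g * x)) ∈ N := by
    rintro _ ⟨b, hb, rfl⟩ g
    refine ⟨single g⁻¹ 1 * b, I.mul_mem_left _ hb, ?_⟩
    funext x
    rw [hL, hL, coeff_single_mul_apply, inv_inv, one_mul]
  have hN : N ≠ ⊥ := by
    intro hbot
    apply ha0
    have h1 : L a ∈ N := ⟨a, haI, rfl⟩
    rw [hbot, Submodule.mem_bot] at h1
    exact hLinj (by rw [h1, map_zero])
  obtain ⟨β₀, ⟨β, hβI, hβ⟩, hsigns, -, hone⟩ := exists_signs_mem_of_forall_translate_mem N hinv hN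
  have hcoeff : ∀ g : G, β.coeff g = β₀ g := fun g => by rw [← hL, hβ]
  refine ⟨β, hβI, fun hb0 => ?_, by rw [hcoeff, hone], fun g => by rw [hcoeff]; exact hsigns g⟩
  have h1 := hcoeff 1
  rw [hb0, hone] at h1
  simp at h1

/-- **LEMMA 3 AS PRINTED — submodules of `ℚ[G]⁻`**: if moreover `I ⊆ ℚ[G]⁻ = {a | c·a = −a}` for an element
`c ∈ G` (White's central involution), the element found is odd: `β(cg) = −β(g)` for all `g`; its coefficients are
`0, ±1`, and `β(1) = 1`, `β(c) = −1`. [cite: White1993SporadicCycles, §4 Lemma 3 and p. 130] -/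
theorem exists_mem_ideal_coeff_signs_odd (c : G) (I : Ideal (MonoidAlgebra ℚ G)) (hI : I ≠ ⊥)
    (hminus : ∀ a ∈ I, single c (1 : ℚ) * a = -a) :
    ∃ β ∈ I, β ≠ 0 ∧ β.coeff 1 = 1 ∧ (∀ g : G, β.coeff g = 0 ∨ β.coeff g = 1 ∨ β.coeff g = -1) ∧
      ∀ g : G, β.coeff (c * g) = -β.coeff g := by
  obtain ⟨β, hβI, hβ0, hone, hs⟩ := exists_mem_ideal_coeff_signs I hI
  refine ⟨β, hβI, hβ0, hone, hs, fun g => ?_⟩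
  have h := congrArg (fun b : MonoidAlgebra ℚ G => b.coeff (c * g)) (hminus β hβI)
  simp only [coeff_single_mul_apply, one_mul, inv_mul_cancel_left, MonoidAlgebra.coeff_neg, Finsupp.coe_neg,
    Pi.neg_apply] at h
  rw [h, neg_neg]

end GroupRing

end WhiteLenstra

end Literature.NumberTheory.ComplexMultiplication
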